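import Mathlib
import HarnessLib
import Summits.ABC.ABC.Theorems.ParitySliceConcordantNormsBreedingMaps

/-!
# Summit strength of `NonSquareTopABC` (stmt-ABC-4010) — crux-strategist r1 workfile

`SquareTopResidualFinite → (ABC ↔ NonSquareTopABC)`: the crux of route `ParitySliceConcordantNorms` is the summit
up to the Faltings-grade finite residual.  `→` of the iff is restriction; `←` is the route's `Assembly`
(`NonSquareTopABC → SquareTopResidualFinite → ABC`, item stmt-ABC-4016), PROVED here (and proposed verbatim to
`Theorems/ParitySliceConcordantNormsAssembly.lean`, p171173; its arithmetic parts 1–2 are LANDED: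
`Theorems/ParitySliceConcordantNormsBreedingArith.lean` p171046, `Theorems/ParitySliceConcordantNormsBreedingMaps.lean`
p171079, imported below).  This is the theorem behind the verdict `no-strategy-short-of-summit` of
`STRATEGY-CENSUS.md` (s1) and `STRATEGY-CENSUS-r1.md` (this seat): every cut of the crux is measured against abc itself.

Proof of `Assembly`: fix `ε`, `ε₀ = min ε 1`, `η = ε₀/10`, `C₁` = the crux constant at `1 + η`.  Non-square tops: the
crux.  Square tops in the residual: finitely many (`c ≤ M`).  Square tops outside the residual: one of the six side
conditions fails and the matching breeding `𝔅/𝔊/ℌ` (or its mirror) of `…BreedingMaps` yields a non-square-top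
abc-triple with `c^d ≤ 81 C'`, `rad' ≤ 24 c^(d-1) rad` (`d = 3, 4`); `transfer` + `unbend` turn the crux bound for it
into `c < (81·C₁·24²)^(1/(1-3η)) · rad^(1+ε₀)`.  rc 0, 0 sorries, standard axioms.
-/

-- `Summit.<Summit>.<Problem>`: for the single-conjunct summit `ABC` the duplicate `ABC.ABC` is mandated.
set_option linter.dupNamespace false

namespace Summit.ABC.ABC.Cruxes.NonSquareTopABC.SummitStrength

open Literature.NumberTheory.DiophantineGeometry
open Summit.ABC.ABC.Theses.ParitySliceConcordantNorms
open UniqueFactorizationMonoid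
open Summit.ABC.ABC.Theorems Summit.ABC.ABC.Theorems.ParitySliceAssembly

/-! ## §5 Transfer of the non-square-top bound through a breeding (real bookkeeping) -/

/-- `1 ≤ rad a b c` for an abc-triple (indeed for any naturals). -/
theorem one_le_rad_real (a b c : ℕ) : (1 : ℝ) ≤ ((rad a b c : ℕ) : ℝ) := by
  have h : 0 < rad a b c := by rw [rad_def]; exact Nat.radical_pos _
  exact_mod_cast h

/-- From a bred triple of degree `d ∈ {3,4}` and the non-square-top bound at exponent `1 + η`
(`0 < η ≤ 1`): `c^(1-3η) < (81·C₁·24²) · rad^(1+η)` for the original triple. -/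
theorem transfer {η C₁ : ℝ} (hη : 0 < η) (hη1 : η ≤ 1) (hC₁ : 0 < C₁)
    (H : ∀ a b c : ℕ, IsABCTriple a b c → ¬ IsSquare c →
      (c : ℝ) < C₁ * ((rad a b c : ℕ) : ℝ) ^ (1 + η))
    {a b c d A B C : ℕ} (hc : 0 < c) (hd : d = 3 ∨ d = 4)
    (hT : IsABCTriple A B C) (hns : ¬ IsSquare C) (hsize : c ^ d ≤ 81 * C)
    (hrad : rad A B C ≤ 24 * c ^ (d - 1) * rad a b c) :
    (c : ℝ) ^ (1 - 3 * η) < (81 * C₁ * 24 ^ (2 : ℝ)) * ((rad a b c : ℕ) : ℝ) ^ (1 + η) := by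
  have hCb := H A B C hT hns
  have hR1 := one_le_rad_real a b c
  have hc1 : (1 : ℝ) ≤ c := by exact_mod_cast hc
  have hx : (0 : ℝ) < c := by positivity
  have hR'0 : (0 : ℝ) ≤ ((rad A B C : ℕ) : ℝ) := by positivity
  have hsizeR : (c : ℝ) ^ (d : ℝ) ≤ 81 * (C : ℝ) := by
    rw [Real.rpow_natCast]; exact_mod_cast hsize
  have hd1 : ((d : ℝ) - 1) = ((d - 1 : ℕ) : ℝ) := by
    rcases hd with rfl | rfl <;> norm_num
  have hradR : ((rad A B C : ℕ) : ℝ) ≤ 24 * (c : ℝ) ^ ((d : ℝ) - 1) * ((rad a b c : ℕ) : ℝ) := by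
    rw [hd1, Real.rpow_natCast]; exact_mod_cast hrad
  have hpos24 : (0 : ℝ) ≤ 24 * (c : ℝ) ^ ((d : ℝ) - 1) * ((rad a b c : ℕ) : ℝ) := by positivity
  -- C < C₁ · (24 c^{d-1} R)^{1+η}
  have h1 : (C : ℝ) < C₁ * (24 * (c : ℝ) ^ ((d : ℝ) - 1) * ((rad a b c : ℕ) : ℝ)) ^ (1 + η) := by
    calc (C : ℝ) < C₁ * ((rad A B C : ℕ) : ℝ) ^ (1 + η) := hCb
      _ ≤ C₁ * (24 * (c : ℝ) ^ ((d : ℝ) - 1) * ((rad a b c : ℕ) : ℝ)) ^ (1 + η) := by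
          gcongr
  have h2 : (24 * (c : ℝ) ^ ((d : ℝ) - 1) * ((rad a b c : ℕ) : ℝ)) ^ (1 + η) =
      (24 : ℝ) ^ (1 + η) * (c : ℝ) ^ (((d : ℝ) - 1) * (1 + η)) *
        ((rad a b c : ℕ) : ℝ) ^ (1 + η) := by
    rw [Real.mul_rpow (by positivity) (by positivity), Real.mul_rpow (by positivity) (by positivity),
      ← Real.rpow_mul hx.le]
  have h24 : (24 : ℝ) ^ (1 + η) ≤ 24 ^ (2 : ℝ) :=
    Real.rpow_le_rpow_of_exponent_le (by norm_num) (by linarith)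
  have h3 : (c : ℝ) ^ (d : ℝ) < (81 * C₁ * 24 ^ (2 : ℝ)) *
      (c : ℝ) ^ (((d : ℝ) - 1) * (1 + η)) * ((rad a b c : ℕ) : ℝ) ^ (1 + η) := by
    have hcpow : (0 : ℝ) ≤ (c : ℝ) ^ (((d : ℝ) - 1) * (1 + η)) := by positivity
    have hRpow : (0 : ℝ) ≤ ((rad a b c : ℕ) : ℝ) ^ (1 + η) := by positivity
    calc (c : ℝ) ^ (d : ℝ) ≤ 81 * C := hsizeR
      _ < 81 * (C₁ * ((24 : ℝ) ^ (1 + η) * (c : ℝ) ^ (((d : ℝ) - 1) * (1 + η)) *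
          ((rad a b c : ℕ) : ℝ) ^ (1 + η))) := by rw [← h2]; linarith [h1]
      _ ≤ 81 * (C₁ * ((24 : ℝ) ^ (2 : ℝ) * (c : ℝ) ^ (((d : ℝ) - 1) * (1 + η)) *
          ((rad a b c : ℕ) : ℝ) ^ (1 + η))) := by gcongr
      _ = _ := by ring
  have h4 : (c : ℝ) ^ ((d : ℝ) - ((d : ℝ) - 1) * (1 + η)) <
      (81 * C₁ * 24 ^ (2 : ℝ)) * ((rad a b c : ℕ) : ℝ) ^ (1 + η) := by
    rw [Real.rpow_sub hx, div_lt_iff₀ (by positivity)]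
    calc (c : ℝ) ^ (d : ℝ) < _ := h3
      _ = _ := by ring
  calc (c : ℝ) ^ (1 - 3 * η) ≤ (c : ℝ) ^ ((d : ℝ) - ((d : ℝ) - 1) * (1 + η)) := by
        apply Real.rpow_le_rpow_of_exponent_le hc1
        rcases hd with rfl | rfl <;> push_cast <;> nlinarith
    _ < _ := h4

/-- Exponent un-bending: from `x^(1-3ε/10) < K · R^(1+ε/10)` (`0 < ε ≤ 1`, `R, x ≥ 1`) to
`x < K^(1/(1-3ε/10)) · R^(1+ε)`. -/
theorem unbend {ε K R x : ℝ} (hε : 0 < ε) (hε1 : ε ≤ 1) (hK : 0 < K) (hR : 1 ≤ R) (hx : 1 ≤ x)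
    (h : x ^ (1 - 3 * (ε / 10)) < K * R ^ (1 + ε / 10)) :
    x < K ^ (1 / (1 - 3 * (ε / 10))) * R ^ (1 + ε) := by
  have he0 : 0 < 1 - 3 * (ε / 10) := by linarith
  have hx0 : 0 ≤ x := by linarith
  have hR0 : 0 ≤ R := by linarith
  have hlhs : 0 ≤ x ^ (1 - 3 * (ε / 10)) := Real.rpow_nonneg hx0 _
  have step1 : x = (x ^ (1 - 3 * (ε / 10))) ^ (1 / (1 - 3 * (ε / 10))) := by
    rw [one_div, Real.rpow_rpow_inv hx0 he0.ne']
  have step2 : (x ^ (1 - 3 * (ε / 10))) ^ (1 / (1 - 3 * (ε / 10))) <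
      (K * R ^ (1 + ε / 10)) ^ (1 / (1 - 3 * (ε / 10))) :=
    Real.rpow_lt_rpow hlhs h (by positivity)
  have step3 : (K * R ^ (1 + ε / 10)) ^ (1 / (1 - 3 * (ε / 10))) =
      K ^ (1 / (1 - 3 * (ε / 10))) * R ^ ((1 + ε / 10) * (1 / (1 - 3 * (ε / 10)))) := by
    rw [Real.mul_rpow hK.le (Real.rpow_nonneg hR0 _), ← Real.rpow_mul hR0]
  have step4 : R ^ ((1 + ε / 10) * (1 / (1 - 3 * (ε / 10)))) ≤ R ^ (1 + ε) := by
    apply Real.rpow_le_rpow_of_exponent_le hR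
    rw [mul_one_div, div_le_iff₀ he0]
    nlinarith
  have hKp : 0 ≤ K ^ (1 / (1 - 3 * (ε / 10))) := Real.rpow_nonneg hK.le _
  calc x = (x ^ (1 - 3 * (ε / 10))) ^ (1 / (1 - 3 * (ε / 10))) := step1
    _ < (K * R ^ (1 + ε / 10)) ^ (1 / (1 - 3 * (ε / 10))) := step2
    _ = K ^ (1 / (1 - 3 * (ε / 10))) * R ^ ((1 + ε / 10) * (1 / (1 - 3 * (ε / 10)))) := step3
    _ ≤ K ^ (1 / (1 - 3 * (ε / 10))) * R ^ (1 + ε) := mul_le_mul_of_nonneg_left step4 hKp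

/-- The bred cases, assembled: a bred package of degree `3` or `4` bounds the original top. -/
theorem bound_of_bred {ε C₁ : ℝ} (hε : 0 < ε) (hε1 : ε ≤ 1) (hC₁ : 0 < C₁)
    (H : ∀ a b c : ℕ, IsABCTriple a b c → ¬ IsSquare c →
      (c : ℝ) < C₁ * ((rad a b c : ℕ) : ℝ) ^ (1 + ε / 10))
    {a b c d : ℕ} (hc : 0 < c) (hd : d = 3 ∨ d = 4)
    (hbred : ∃ A' B' C' : ℕ, IsABCTriple A' B' C' ∧ ¬ IsSquare C' ∧ c ^ d ≤ 81 * C' ∧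
      rad A' B' C' ≤ 24 * c ^ (d - 1) * rad a b c) :
    (c : ℝ) < (81 * C₁ * 24 ^ (2 : ℝ)) ^ (1 / (1 - 3 * (ε / 10))) *
      ((rad a b c : ℕ) : ℝ) ^ (1 + ε) := by
  obtain ⟨A, B, C, hT, hns, hsize, hrad⟩ := hbred
  have h := transfer (η := ε / 10) (by positivity) (by linarith) hC₁ H hc hd hT hns hsize hrad
  exact unbend hε hε1 (by positivity) (one_le_rad_real a b c) (by exact_mod_cast hc) h


/-- **Assembly of route `ParitySliceConcordantNorms`** (`NonSquareTopABC → SquareTopResidualFinite → ABC`):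
abc for non-square tops plus finiteness of the square-top residual gives the abc conjecture, the
square tops outside the residual being bred — by one of the explicit degree-3/4 identities `𝔅`, `𝔊`, `ℌ`
(or their mirrors) — into non-square-top triples of comparable quality. Unconditional; no named facts. -/
theorem paritySliceConcordantNorms_assembly : Assembly := by
  intro hT hFin ε hε
  -- exponents and the non-square-top constant
  have hε₀ : 0 < min ε 1 := lt_min hε one_pos
  have hε₀1 : min ε 1 ≤ 1 := min_le_right _ _
  have hε₀ε : min ε 1 ≤ ε := min_le_left _ _
  obtain ⟨C₁, hC₁, H₁⟩ := hT (min ε 1 / 10) (by positivity)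
  -- the finite residual
  have hS : Set.Finite _ := hFin
  -- constants
  set M : ℕ := hS.toFinset.sup (fun t => t.2.2) with hMdef
  set Cfin : ℝ := (81 * C₁ * 24 ^ (2 : ℝ)) ^ (1 / (1 - 3 * (min ε 1 / 10))) with hCfin
  have hCfin0 : 0 < Cfin := Real.rpow_pos_of_pos (by positivity) _
  refine ⟨(M : ℝ) + 1 + C₁ + Cfin, by positivity, ?_⟩
  intro a b c ht
  have hc : 0 < c := by obtain ⟨ha, -, habc, -⟩ := ht; omega
  have hR1 := one_le_rad_real a b c
  have hRε : (1 : ℝ) ≤ ((rad a b c : ℕ) : ℝ) ^ (1 + ε) := Real.one_le_rpow hR1 (by linarith)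
  -- a bound `c < D · R^(1+e)` with `D ≤ M+1+C₁+Cfin`, `e ≤ ε` suffices
  have finish : ∀ D e : ℝ, 0 ≤ D → D ≤ (M : ℝ) + 1 + C₁ + Cfin → e ≤ ε →
      (c : ℝ) < D * ((rad a b c : ℕ) : ℝ) ^ (1 + e) →
      (c : ℝ) < ((M : ℝ) + 1 + C₁ + Cfin) * ((rad a b c : ℕ) : ℝ) ^ (1 + ε) := by
    intro D e hD0 hD he h
    calc (c : ℝ) < D * ((rad a b c : ℕ) : ℝ) ^ (1 + e) := h
      _ ≤ ((M : ℝ) + 1 + C₁ + Cfin) * ((rad a b c : ℕ) : ℝ) ^ (1 + ε) :=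
          mul_le_mul hD (Real.rpow_le_rpow_of_exponent_le hR1 (by linarith)) (by positivity)
            (by positivity)
  by_cases hsq : IsSquare c
  swap
  · -- non-square top: the crux applies directly
    exact finish C₁ (min ε 1 / 10) hC₁.le (by linarith [hCfin0]) (by linarith) (H₁ a b c ht hsq)
  by_cases hmem : (a, b, c) ∈ hS.toFinset
  · -- inside the finite residual: `c ≤ M`
    have hcM : c ≤ M := Finset.le_sup (f := fun t : ℕ × ℕ × ℕ => t.2.2) hmem
    have hcM' : (c : ℝ) ≤ M := by exact_mod_cast hcM
    calc (c : ℝ) < (M : ℝ) + 1 := by linarith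
      _ ≤ ((M : ℝ) + 1 + C₁ + Cfin) * 1 := by linarith [hCfin0]
      _ ≤ ((M : ℝ) + 1 + C₁ + Cfin) * ((rad a b c : ℕ) : ℝ) ^ (1 + ε) :=
          mul_le_mul_of_nonneg_left hRε (by positivity)
  · -- square top outside the residual: one of the six conditions fails, so we can breed
    have hnot : ¬ ((IsSquare b ∨ 3 * b ≤ a) ∧ (IsSquare a ∨ 3 * a ≤ b) ∧
        (IsSquare (a + 3 * b) ∨ IsSquare (3 * (a + 3 * b))) ∧
        (IsSquare (3 * a + b) ∨ IsSquare (3 * (3 * a + b))) ∧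
        (a ≤ 2 * b ∨ IsSquare (a - b)) ∧ (b ≤ 2 * a ∨ IsSquare (b - a))) := by
      intro h6
      exact hmem (hS.mem_toFinset.mpr ⟨ht, hsq, h6⟩)
    have hbred : ∀ d : ℕ, (d = 3 ∨ d = 4) →
        (∃ A' B' C' : ℕ, IsABCTriple A' B' C' ∧ ¬ IsSquare C' ∧ c ^ d ≤ 81 * C' ∧
          rad A' B' C' ≤ 24 * c ^ (d - 1) * rad a b c) →
        (c : ℝ) < ((M : ℝ) + 1 + C₁ + Cfin) * ((rad a b c : ℕ) : ℝ) ^ (1 + ε) := by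
      intro d hd hb
      exact finish Cfin (min ε 1) hCfin0.le (by linarith) hε₀ε
        (bound_of_bred hε₀ hε₀1 hC₁ H₁ hc hd hb)
    have ht' : IsABCTriple b a c := DepthCountedABC.isABCTriple_swap ht
    simp only [not_and_or, not_or, not_le] at hnot
    rcases hnot with ⟨hb, h3⟩ | ⟨ha, h3⟩ | ⟨h1, h3⟩ | ⟨h1, h3⟩ | ⟨h2, hns⟩ | ⟨h2, hns⟩
    · exact hbred 3 (Or.inl rfl) (breed_B ht hsq hb h3)
    · obtain ⟨A, B, C, h⟩ := breed_B ht' hsq ha h3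
      rw [rad_swap a b c] at h
      exact hbred 3 (Or.inl rfl) ⟨A, B, C, h⟩
    · exact hbred 4 (Or.inr rfl) (breed_H ht hsq h1 h3)
    · rw [show 3 * a + b = b + 3 * a by ring] at h1 h3
      obtain ⟨A, B, C, h⟩ := breed_H ht' hsq h1 h3
      rw [rad_swap a b c] at h
      exact hbred 4 (Or.inr rfl) ⟨A, B, C, h⟩
    · exact hbred 4 (Or.inr rfl) (breed_G ht hsq h2 hns)
    · obtain ⟨A, B, C, h⟩ := breed_G ht' hsq h2 hns
      rw [rad_swap a b c] at h
      exact hbred 4 (Or.inr rfl) ⟨A, B, C, h⟩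

/-- **Summit strength of the crux.** Given finiteness of the square-top residual, the abc conjecture is
*equivalent* to abc for non-square tops (`NonSquareTopABC`, item stmt-ABC-4010). -/
theorem abc_iff_nonSquareTopABC (hFin : SquareTopResidualFinite) : _root_.ABC ↔ NonSquareTopABC :=
  ⟨fun h ε hε => by
    obtain ⟨C, hC, hb⟩ := h ε hε
    exact ⟨C, hC, fun a b c ht _ => hb a b c ht⟩,
   fun h => paritySliceConcordantNorms_assembly h hFin⟩

/-- The two directions packaged without the iff: restriction, and the proved Assembly. -/
theorem summit_strength :
    (_root_.ABC → NonSquareTopABC) ∧ (NonSquareTopABC → SquareTopResidualFinite → _root_.ABC) :=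
  ⟨fun h ε hε => by
    obtain ⟨C, hC, hb⟩ := h ε hε
    exact ⟨C, hC, fun a b c ht _ => hb a b c ht⟩,
   paritySliceConcordantNorms_assembly⟩

end Summit.ABC.ABC.Cruxes.NonSquareTopABC.SummitStrength
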